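import Summits.BirchSwinnertonDyer.BirchSwinnertonDyer.Theses.CumulativeHeegnerLeopoldt
import Summits.BirchSwinnertonDyer.BirchSwinnertonDyer.Theorems.UniversalToricDescentAcDualMuZeroCriterion
import Summits.BirchSwinnertonDyer.BirchSwinnertonDyer.Theorems.UniversalToricDescentCharIdealVacuity
import HarnessLib

/-!
# Route `CumulativeHeegnerLeopoldt`, crux K1 `CumulativeHeegnerInclusionAtThree` (stmt-BirchSwinnertonDyer-24198),
# line `birth`, registered STUB B `stub_charPrincipalMuZero`: WHAT THE STUB SAYS, and three sufficient conditions

STUB B of the line `birth` (skeleton v2 `d95f5b560a5dd8c3`, `Cruxes/CumulativeHeegnerInclusionAtThree/Lines/birth.lean`)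
asks, at every frame of the crux, for a generator `g` of the extended characteristic ideal
`Ch_Λ(X_{∅,0}(𝔭′))·R₀⟦T⟧` (`X_{∅,0}(𝔭′) = AcSelmer.XAc (E/K) 3 κ 𝔭′ ∅ γ`, Castella's anticyclotomic Selmer dual,
strict at `𝔭′`, relaxed at the other prime above `3`) having SOME coefficient of norm `1` in `ℂ₃`. This file
pins down the content of that conclusion by PURE `Λ`-ALGEBRA on the constructed object (no elliptic-curve
arithmetic is used beyond the tree's finite generation of `X`, `AcSelmer.XAc.module_finite`):

* §1 (every prime `p`, every `Λ`-module `M`, NO finiteness or torsion hypothesis):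
  `Ch_Λ(M)·R₀⟦T⟧ = (g)` with a norm-one coefficient of `g` **iff `Ch_Λ(M) ⊄ (p)`**, i.e. `p` does not divide
  the (principal, tree `charIdeal_isPrincipal_holds`) characteristic ideal
  (`exists_generator_iff_not_charIdeal_le_augIdealP`). Hence the conclusion is junk-TRUE off the torsion
  locus (`Ch = ⊤`, tree `charIdeal_eq_top_of_not_isTorsion`) and, for finitely generated torsion `M`, it is
  EXACTLY `μ(M) = 0` (tree `muInvariant_eq_zero_iff_exists_map_charIdeal_eq_span`, here reshaped to the
  stub's `∃ g n` form): `exists_generator_iff_isTorsion_imp_muInvariant_eq_zero`.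
* §2 (Castella's `X_ac^Σ`, finite `Σ`): the conclusion holds iff `X` torsion ⇒ `μ(X) = 0`, and it FOLLOWS from
  finiteness of the residual Selmer group `Sel_𝔭^Σ(K_∞, E[p^∞])[p]` (Greenberg's criterion (A), tree
  `isTorsion_and_exists_generator_of_finite_pTorsion`).
* §3 (the registered stub, `p = 3`, signature VERBATIM): STUB B follows from EACH of
  (i) the `L`-free cell statement «`Ch_Λ(X_{∅,0}(𝔭′)) ⊄ (3)` at every algebraic frame of the Leopoldt cell»
      (`stub_charPrincipalMuZero_of_forall_not_le`),
  (ii) «`Sel_{𝔭′}^∅(K_∞, E[3^∞])[3]` finite at every algebraic frame» (`stub_charPrincipalMuZero_of_forall_finite`),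
  (iii) the route's crux K2 `EisensteinCharacterInvariantsAtThree` (stmt-BirchSwinnertonDyer-24199) BY NAME — its
      clauses 1 and 3 are stub B (`stub_charPrincipalMuZero_of_eisensteinCharacterInvariantsAtThree`).
  So stub B is the algebraic `μ = 0` of `X_{∅,0}` on the torsion locus and nothing more; at an additive
  Eisenstein prime `p = 3` this is not in print (Castella–Grossi–Lee–Skinner 2022 / Castella–Grossi–Skinner
  treat good ordinary `p`), which is why K2 is a crux.

THEOREMS ONLY (`--supports stmt-BirchSwinnertonDyer-24198`); no definition, no named fact, no `sorry`. Seat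
bsd-line-chl-k1-p1-w2 (width prover on line `birth`). BSD is not proved by any of this.

References: [GreenbergVatsal2000] p. 2 (1)–(2), §2 Prop. (2.8); [Washington1997] §13.2; [GreenbergLNM1716] §1
p. 60; [Castella2018] §2.1–2.2, Thm. 2.3; [CastellaGrossiLeeSkinner2022] Thm. C (scope: good ordinary `p`).
-/

set_option autoImplicit false
set_option linter.dupNamespace false

noncomputable section

open scoped Classical

namespace Summit.BirchSwinnertonDyer.BirchSwinnertonDyer.Theorems.CumulativeHeegnerInclusionAtThreeStubB

open Literature.NumberTheory.EllipticCurves Literature.NumberTheory.EllipticCurves.IwasawaAlgebra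
  Literature.NumberTheory.GaloisRepresentations NumberField IsDedekindDomain Field
  Summit.BirchSwinnertonDyer.Rank1Residual.X11b Summit.BirchSwinnertonDyer.Rank1Residual.X11b.AcSelmer
  Summit.BirchSwinnertonDyer.BirchSwinnertonDyer.Theorems.UniversalToricDescentAcDualMuZero
  Summit.BirchSwinnertonDyer.BirchSwinnertonDyer.Theorems.UniversalToricDescentCharIdealVacuity

universe u

/-! ### §1 The conclusion shape of stub B, for an arbitrary `Λ`-module -/

section Algebra

variable {p : ℕ} [hp : Fact p.Prime]

/-- **Principal version.** For `f ∈ Λ = ℤ_p⟦T⟧`: the extended ideal `(f)·R₀⟦T⟧` has a generator with a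
coefficient of norm `1` iff `p ∤ f` in `Λ`. (`⇐`: a coefficient of `f` not divisible by `p` is a unit of `ℤ_p`,
and `ℤ_p → R₀` is isometric; `⇒`: if `f = p·h` then every generator of `(f)·R₀⟦T⟧ = (p·h)` is `p·h·u` for a unit
`u` of the domain `R₀⟦T⟧`, all of whose coefficients have norm `≤ ‖p‖ < 1`.)
[cite: GreenbergVatsal2000, p. 2, (1)–(2)] -/
theorem exists_generator_iff_not_C_dvd (f : IwasawaAlgebra p) :
    (∃ (g : UnrSeries p) (n : ℕ),
        (Ideal.span ({f} : Set (IwasawaAlgebra p))).map (PowerSeries.map (Halves.toUnr p)) = Ideal.span {g} ∧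
          ‖((PowerSeries.coeff n g : unrIntegers p) : ℂ_[p])‖ = 1) ↔
      ¬ PowerSeries.C (p : ℤ_[p]) ∣ f := by
  constructor
  · rintro ⟨g, n, hg, hn⟩ ⟨h, rfl⟩
    rw [map_span_singleton_toUnr] at hg
    obtain ⟨u, hu⟩ := Ideal.span_singleton_eq_span_singleton.mp hg
    have hmap : PowerSeries.map (Halves.toUnr p) (PowerSeries.C (p : ℤ_[p]) * h) =
        PowerSeries.C (Halves.toUnr p (p : ℤ_[p])) * PowerSeries.map (Halves.toUnr p) h := by
      rw [map_mul, PowerSeries.map_C]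
    have hcoeff : PowerSeries.coeff n g = Halves.toUnr p (p : ℤ_[p]) *
        PowerSeries.coeff n (PowerSeries.map (Halves.toUnr p) h * (u : UnrSeries p)) := by
      rw [← hu, hmap, mul_assoc, PowerSeries.coeff_C_mul]
    have hlt : ‖((PowerSeries.coeff n g : unrIntegers p) : ℂ_[p])‖ < 1 := by
      rw [hcoeff, Subring.coe_mul, norm_mul, norm_coe_toUnr]
      calc ‖(p : ℤ_[p])‖ *
            ‖((PowerSeries.coeff n (PowerSeries.map (Halves.toUnr p) h * (u : UnrSeries p)) :
              unrIntegers p) : ℂ_[p])‖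
          ≤ ‖(p : ℤ_[p])‖ * 1 :=
            mul_le_mul_of_nonneg_left (Halves.norm_coe_unrIntegers_le_one p _) (norm_nonneg _)
        _ < 1 := by
            rw [mul_one, PadicInt.norm_p]
            exact inv_lt_one_of_one_lt₀ (by exact_mod_cast hp.out.one_lt)
    exact absurd hn hlt.ne
  · intro hndvd
    rw [Literature.NumberTheory.EllipticCurves.PowerSeries.C_dvd_iff_forall_dvd_coeff, not_forall] at hndvd
    obtain ⟨n, hn⟩ := hndvd
    have hunit : IsUnit (PowerSeries.coeff n f) := by
      rw [PadicInt.isUnit_iff]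
      exact le_antisymm (PadicInt.norm_le_one _) (not_lt.mp (mt (PadicInt.norm_lt_one_iff_dvd _).mp hn))
    exact ⟨PowerSeries.map (Halves.toUnr p) f, n, map_span_singleton_toUnr f,
      (isUnit_coeff_iff_norm_toUnr_eq_one f n).mp hunit⟩

variable (M : Type*) [AddCommGroup M] [Module (IwasawaAlgebra p) M]

/-- **What stub B's conclusion says, for ANY `Λ`-module `M` (no finiteness, no torsion hypothesis):**
`Ch_Λ(M)·R₀⟦T⟧ = (g)` for some `g` with a norm-one coefficient iff `Ch_Λ(M) ⊄ (p)` — `p` does not divide the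
characteristic ideal (`Ch_Λ(M)` is principal, tree `charIdeal_isPrincipal_holds`, and
`exists_generator_iff_not_C_dvd`). [cite: GreenbergVatsal2000, p. 2, (1)–(2)] [cite: Washington1997, §13.2] -/
theorem exists_generator_iff_not_charIdeal_le_augIdealP :
    (∃ (g : UnrSeries p) (n : ℕ),
        (Module.charIdeal (IwasawaAlgebra p) M).map (PowerSeries.map (Halves.toUnr p)) = Ideal.span {g} ∧
          ‖((PowerSeries.coeff n g : unrIntegers p) : ℂ_[p])‖ = 1) ↔
      ¬ Module.charIdeal (IwasawaAlgebra p) M ≤ augIdealP p := by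
  obtain ⟨f, hf⟩ := (charIdeal_isPrincipal_holds p M).principal
  have hf' : Module.charIdeal (IwasawaAlgebra p) M = Ideal.span {f} := hf
  rw [hf', exists_generator_iff_not_C_dvd, augIdealP, Ideal.span_singleton_le_span_singleton]

/-- **Off the torsion locus stub B's conclusion is junk-TRUE**: if `M` is not `Λ`-torsion then `Ch_Λ(M) = ⊤`
(tree `charIdeal_eq_top_of_not_isTorsion`), so `g = 1`, `n = 0` serve.
[cite: Washington1997, §13.2 (characteristic ideal of a torsion Λ-module; junk off torsion)] -/
theorem exists_generator_of_not_isTorsion (h : ¬ Module.IsTorsion (IwasawaAlgebra p) M) :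
    ∃ (g : UnrSeries p) (n : ℕ),
      (Module.charIdeal (IwasawaAlgebra p) M).map (PowerSeries.map (Halves.toUnr p)) = Ideal.span {g} ∧
        ‖((PowerSeries.coeff n g : unrIntegers p) : ℂ_[p])‖ = 1 := by
  refine ⟨1, 0, ?_, ?_⟩
  · rw [charIdeal_eq_top_of_not_isTorsion h, Ideal.map_top, Ideal.span_singleton_one]
  · rw [PowerSeries.coeff_zero_eq_constantCoeff, map_one, Subring.coe_one, norm_one]

/-- **On the torsion locus stub B's conclusion is `μ = 0`** (finitely generated torsion `M`; tree
`muInvariant_eq_zero_iff_exists_map_charIdeal_eq_span`, reshaped to the stub's `∃ g n` form).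
[cite: GreenbergVatsal2000, p. 2, (1)–(2)] [cite: Washington1997, §13.2] -/
theorem exists_generator_iff_muInvariant_eq_zero [Module.Finite (IwasawaAlgebra p) M]
    (hM : Module.IsTorsion (IwasawaAlgebra p) M) :
    (∃ (g : UnrSeries p) (n : ℕ),
        (Module.charIdeal (IwasawaAlgebra p) M).map (PowerSeries.map (Halves.toUnr p)) = Ideal.span {g} ∧
          ‖((PowerSeries.coeff n g : unrIntegers p) : ℂ_[p])‖ = 1) ↔
      muInvariant p M = 0 := by
  rw [muInvariant_eq_zero_iff_exists_map_charIdeal_eq_span M hM]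
  exact ⟨fun ⟨g, n, hg, hn⟩ ↦ ⟨g, hg, n, hn⟩, fun ⟨g, hg, n, hn⟩ ↦ ⟨g, n, hg, hn⟩⟩

/-- **Stub B's conclusion for a finitely generated `Λ`-module, exactly**: it holds iff
`M` torsion ⇒ `μ(M) = 0` (junk-true off torsion, `μ = 0` on torsion).
[cite: GreenbergVatsal2000, p. 2, (1)–(2)] [cite: Washington1997, §13.2] -/
theorem exists_generator_iff_isTorsion_imp_muInvariant_eq_zero [Module.Finite (IwasawaAlgebra p) M] :
    (∃ (g : UnrSeries p) (n : ℕ),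
        (Module.charIdeal (IwasawaAlgebra p) M).map (PowerSeries.map (Halves.toUnr p)) = Ideal.span {g} ∧
          ‖((PowerSeries.coeff n g : unrIntegers p) : ℂ_[p])‖ = 1) ↔
      (Module.IsTorsion (IwasawaAlgebra p) M → muInvariant p M = 0) := by
  by_cases hM : Module.IsTorsion (IwasawaAlgebra p) M
  · rw [exists_generator_iff_muInvariant_eq_zero M hM]
    exact ⟨fun h _ ↦ h, fun h ↦ h hM⟩
  · exact ⟨fun _ h ↦ absurd h hM, fun _ ↦ exists_generator_of_not_isTorsion M hM⟩

end Algebra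

/-! ### §2 Castella's `X_ac^Σ(E[p^∞])` (finite `Σ`) -/

section XAc

variable {K : Type u} [Field K] [NumberField K] (W : WeierstrassCurve K) (p : ℕ) [hp : Fact p.Prime]
  (κ : ZpExtension K p) (𝔭 : HeightOneSpectrum (𝓞 K)) (S : Set (HeightOneSpectrum (𝓞 K)))
  (γ : absoluteGaloisGroup K) [hγ : Fact (κ.IsTopGenerator γ)]

/-- **Stub B's conclusion for `X = X_ac^Σ(E[p^∞])` (finite `Σ`) iff `X` torsion ⇒ `μ(X) = 0`** — `X` is
finitely generated over `Λ` (tree `XAc.module_finite`). [cite: Castella2018, §2.1–2.2 (arXiv:1704.06608 p. 5)] [cite: GreenbergVatsal2000, p. 2, (1)–(2)] -/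
theorem xac_exists_generator_iff [W.IsElliptic] (hS : S.Finite) :
    (∃ (g : UnrSeries p) (n : ℕ),
        (XAc.charIdeal W p κ 𝔭 S γ).map (PowerSeries.map (Halves.toUnr p)) = Ideal.span {g} ∧
          ‖((PowerSeries.coeff n g : unrIntegers p) : ℂ_[p])‖ = 1) ↔
      (Module.IsTorsion (IwasawaAlgebra p) (XAc W p κ 𝔭 S γ) → muInvariant p (XAc W p κ 𝔭 S γ) = 0) := by
  haveI := XAc.module_finite κ 𝔭 S γ hS (W := W)
  exact exists_generator_iff_isTorsion_imp_muInvariant_eq_zero (XAc W p κ 𝔭 S γ)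

/-- **Stub B's conclusion for `X_ac^Σ(E[p^∞])` iff `p` does not divide `Ch_Λ(X_ac^Σ)`** (any `Σ`; the
`L`-free reading). [cite: Castella2018, Thm. 2.3 (arXiv:1704.06608 p. 5)] [cite: GreenbergVatsal2000, p. 2, (1)–(2)] -/
theorem xac_exists_generator_iff_not_le_augIdealP :
    (∃ (g : UnrSeries p) (n : ℕ),
        (XAc.charIdeal W p κ 𝔭 S γ).map (PowerSeries.map (Halves.toUnr p)) = Ideal.span {g} ∧
          ‖((PowerSeries.coeff n g : unrIntegers p) : ℂ_[p])‖ = 1) ↔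
      ¬ XAc.charIdeal W p κ 𝔭 S γ ≤ augIdealP p :=
  exists_generator_iff_not_charIdeal_le_augIdealP (XAc W p κ 𝔭 S γ)

/-- **Greenberg's criterion (A) gives stub B's conclusion**: if the residual Selmer group
`Sel_𝔭^Σ(K_∞, E[p^∞])[p]` is finite (finite `Σ`), then `Ch_Λ(X_ac^Σ)·R₀⟦T⟧ = (g)` with a norm-one coefficient
(and `X_ac^Σ` is torsion; tree `isTorsion_and_exists_generator_of_finite_pTorsion`).
[cite: GreenbergVatsal2000, §2 Prop. (2.8)] [cite: GreenbergLNM1716, §1 p. 60] -/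
theorem xac_exists_generator_of_finite_pTorsion [W.IsElliptic] (hS : S.Finite)
    (hfin : Set.Finite {s : selmerAc W p κ 𝔭 S | p • s = 0}) :
    ∃ (g : UnrSeries p) (n : ℕ),
      (XAc.charIdeal W p κ 𝔭 S γ).map (PowerSeries.map (Halves.toUnr p)) = Ideal.span {g} ∧
        ‖((PowerSeries.coeff n g : unrIntegers p) : ℂ_[p])‖ = 1 := by
  obtain ⟨-, g, hg, n, hn⟩ := isTorsion_and_exists_generator_of_finite_pTorsion W p κ 𝔭 S γ hS hfin
  exact ⟨g, n, hg, hn⟩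

end XAc

/-! ### §3 The registered stub B of line `birth` (p = 3): three sufficient conditions -/

section StubB

/-- **STUB B ⇐ the `L`-free cell statement «`3 ∤ Ch_Λ(X_{∅,0}(𝔭′))`».** If at every algebraic frame of the
Leopoldt cell (same binders as the stub up to `𝔭′ ≠ 𝔭`; no embedding datum, periods or BDP measure) the
characteristic ideal of `X_{∅,0}(𝔭′) = XAc (E/K) 3 κ 𝔭′ ∅ γ` is not contained in `(3)`, then the registered stub
`stub_charPrincipalMuZero` of `Cruxes/CumulativeHeegnerInclusionAtThree/Lines/birth.lean` holds (signature
verbatim as the conclusion). [cite: GreenbergVatsal2000, p. 2, (1)–(2)] [cite: Castella2018, Thm. 2.3 (arXiv:1704.06608 p. 5)] -/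
theorem stub_charPrincipalMuZero_of_forall_not_le
    (h : ∀ (W : WeierstrassCurve ℚ) [W.IsElliptic] [W.IsGloballyMinimal] (N : ℕ) [NeZero N] (K : Type) [Field K]
      [NumberField K] (_Dt : Literature.NumberTheory.EllipticCurves.ModularForms.ModularParametrizationData W N),
      Summit.BirchSwinnertonDyer.Rank1Residual.Additive.ClassO6 W 3 →
      Literature.NumberTheory.EllipticCurves.Rank1Residual.Red W 3 →
      (∃ Φ : AddSubgroup (WeierstrassCurve.geomTorsion W ((3 : ℕ) : ℤ)),
        Literature.NumberTheory.EllipticCurves.Rank1Residual.IsRationalLine W 3 Φ ∧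
        ∀ (v : IsDedekindDomain.HeightOneSpectrum (NumberField.RingOfIntegers ℚ)),
          ((3 : ℕ) : NumberField.RingOfIntegers ℚ) ∈ v.asIdeal → ∀ 𝔓 ∈ v.primesAbove,
          ¬ (∀ g ∈ 𝔓.decompositionSubgroup (Field.absoluteGaloisGroup ℚ), ∀ P ∈ Φ, g • P = P) ∧
          ¬ (∀ g ∈ 𝔓.decompositionSubgroup (Field.absoluteGaloisGroup ℚ),
            ∀ P : WeierstrassCurve.geomTorsion W ((3 : ℕ) : ℤ), g • P - P ∈ Φ)) →
      W.analyticRank = 1 → W.conductorNorm ℤ = N →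
      Literature.NumberTheory.EllipticCurves.IsImaginaryQuadratic K →
      Literature.NumberTheory.EllipticCurves.SatisfiesHeegnerHypothesis N K →
      ∀ (κ : Literature.NumberTheory.EllipticCurves.ZpExtension K 3), κ.IsAnticyclotomic →
      ∀ (γ : Field.absoluteGaloisGroup K) [Fact (κ.IsTopGenerator γ)]
        (𝔭 : IsDedekindDomain.HeightOneSpectrum (NumberField.RingOfIntegers K)),
        ((3 : ℕ) : NumberField.RingOfIntegers K) ∈ 𝔭.asIdeal →
        𝔭.asIdeal.ramificationIdx (NumberField.RingOfIntegers ℚ) = 1 →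
        𝔭.asIdeal.inertiaDeg (NumberField.RingOfIntegers ℚ) = 1 →
      ∀ (𝔭' : IsDedekindDomain.HeightOneSpectrum (NumberField.RingOfIntegers K)),
        ((3 : ℕ) : NumberField.RingOfIntegers K) ∈ 𝔭'.asIdeal → 𝔭' ≠ 𝔭 →
      ¬ Summit.BirchSwinnertonDyer.Rank1Residual.X11b.AcSelmer.XAc.charIdeal (W.baseChange K) 3 κ 𝔭' ∅ γ ≤
          augIdealP 3) :
    ∀ (W : WeierstrassCurve ℚ) [W.IsElliptic] [W.IsGloballyMinimal] (N : ℕ) [NeZero N] (K : Type) [Field K] [NumberField K] (Dt : Literature.NumberTheory.EllipticCurves.ModularForms.ModularParametrizationData W N), Summit.BirchSwinnertonDyer.Rank1Residual.Additive.ClassO6 W 3 → Literature.NumberTheory.EllipticCurves.Rank1Residual.Red W 3 → (∃ Φ : AddSubgroup (WeierstrassCurve.geomTorsion W ((3 : ℕ) : ℤ)), Literature.NumberTheory.EllipticCurves.Rank1Residual.IsRationalLine W 3 Φ ∧ ∀ (v : IsDedekindDomain.HeightOneSpectrum (NumberField.RingOfIntegers ℚ)), ((3 : ℕ) : NumberField.RingOfIntegers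 ℚ) ∈ v.asIdeal → ∀ 𝔓 ∈ v.primesAbove, ¬ (∀ g ∈ 𝔓.decompositionSubgroup (Field.absoluteGaloisGroup ℚ), ∀ P ∈ Φ, g • P = P) ∧ ¬ (∀ g ∈ 𝔓.decompositionSubgroup (Field.absoluteGaloisGroup ℚ), ∀ P : WeierstrassCurve.geomTorsion W ((3 : ℕ) : ℤ), g • P - P ∈ Φ)) → W.analyticRank = 1 → W.conductorNorm ℤ = N → Literature.NumberTheory.EllipticCurves.IsImaginaryQuadratic K → Literature.NumberTheory.EllipticCurves.SatisfiesHeegnerHypothesis N K → ∀ (κ : Literature.NumberTheory.EllipticCurves.ZpExtension K 3), κ.IsAnticyclotomic → ∀ (γ : Field.absoluteGaloisGroup K) [Fact (κ.IsTopGenerator γ)] (𝔭 : IsDedekindDomain.HeightOneSpectrum (NumberField.RingOfIntegers K)), ((3 : ℕ) : NumberField.RingOfIntegers K) ∈ 𝔭.asIdeal → 𝔭.asIdeal.ramificationIdx (NumberField.RingOfIntegers ℚ) = 1 → 𝔭.asIdeal.inertiaDeg (NumberField.RingOfIntegers ℚ) = 1 → ∀ (𝔭' : IsDedekindDomain.HeightOneSpectrum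 (NumberField.RingOfIntegers K)), ((3 : ℕ) : NumberField.RingOfIntegers K) ∈ 𝔭'.asIdeal → 𝔭' ≠ 𝔭 → ∀ (ι' : PadicAlgCl 3 ≃+* ℂ), Summit.BirchSwinnertonDyer.BirchSwinnertonDyer.Theorems.SchneiderFree.BranchInducesPrime 3 ι' 𝔭 → ∀ (ΩK : ℂ) (Ωp : ℂ_[3]) (L : Literature.NumberTheory.EllipticCurves.UnrSeries 3), ΩK ≠ 0 → Ωp ≠ 0 → Literature.NumberTheory.EllipticCurves.IsBDPLFunction ι' 𝔭 κ γ Dt.f ΩK Ωp L → ∃ (g : Literature.NumberTheory.EllipticCurves.UnrSeries 3) (n : ℕ), (Summit.BirchSwinnertonDyer.Rank1Residual.X11b.AcSelmer.XAc.charIdeal (W.baseChange K) 3 κ 𝔭' ∅ γ).map (PowerSeries.map (Summit.BirchSwinnertonDyer.Rank1Residual.X11b.Halves.toUnr 3)) = Ideal.span {g} ∧ ‖((PowerSeries.coeff n g : Literature.NumberTheory.EllipticCurves.unrIntegers 3) : ℂ_[3])‖ = 1 := by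
  intro W _ _ N _ K _ _ Dt hO6 hRed hcell hr hN hK hHg κ hκ γ _ 𝔭 h𝔭 he hf 𝔭' h𝔭' hne _ι' _hι _ΩK _Ωp _L _hΩK
    _hΩp _hBDP
  exact (xac_exists_generator_iff_not_le_augIdealP (W.baseChange K) 3 κ 𝔭' ∅ γ).mpr
    (h W N K Dt hO6 hRed hcell hr hN hK hHg κ hκ γ 𝔭 h𝔭 he hf 𝔭' h𝔭' hne)

/-- **STUB B ⇐ finiteness of the residual Selmer group on the cell.** If at every algebraic frame of the
Leopoldt cell the `3`-torsion `Sel_{𝔭′}^∅(K_∞, E[3^∞])[3]` of Castella's anticyclotomic Selmer group (strict at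
`𝔭′`) is finite, then the registered stub `stub_charPrincipalMuZero` holds (signature verbatim as the
conclusion) — Greenberg's criterion (A) on the constructed `X_{∅,0}`.
[cite: GreenbergVatsal2000, §2 Prop. (2.8)] [cite: GreenbergLNM1716, §1 p. 60] -/
theorem stub_charPrincipalMuZero_of_forall_finite
    (h : ∀ (W : WeierstrassCurve ℚ) [W.IsElliptic] [W.IsGloballyMinimal] (N : ℕ) [NeZero N] (K : Type) [Field K]
      [NumberField K] (_Dt : Literature.NumberTheory.EllipticCurves.ModularForms.ModularParametrizationData W N),
      Summit.BirchSwinnertonDyer.Rank1Residual.Additive.ClassO6 W 3 →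
      Literature.NumberTheory.EllipticCurves.Rank1Residual.Red W 3 →
      (∃ Φ : AddSubgroup (WeierstrassCurve.geomTorsion W ((3 : ℕ) : ℤ)),
        Literature.NumberTheory.EllipticCurves.Rank1Residual.IsRationalLine W 3 Φ ∧
        ∀ (v : IsDedekindDomain.HeightOneSpectrum (NumberField.RingOfIntegers ℚ)),
          ((3 : ℕ) : NumberField.RingOfIntegers ℚ) ∈ v.asIdeal → ∀ 𝔓 ∈ v.primesAbove,
          ¬ (∀ g ∈ 𝔓.decompositionSubgroup (Field.absoluteGaloisGroup ℚ), ∀ P ∈ Φ, g • P = P) ∧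
          ¬ (∀ g ∈ 𝔓.decompositionSubgroup (Field.absoluteGaloisGroup ℚ),
            ∀ P : WeierstrassCurve.geomTorsion W ((3 : ℕ) : ℤ), g • P - P ∈ Φ)) →
      W.analyticRank = 1 → W.conductorNorm ℤ = N →
      Literature.NumberTheory.EllipticCurves.IsImaginaryQuadratic K →
      Literature.NumberTheory.EllipticCurves.SatisfiesHeegnerHypothesis N K →
      ∀ (κ : Literature.NumberTheory.EllipticCurves.ZpExtension K 3), κ.IsAnticyclotomic →
      ∀ (γ : Field.absoluteGaloisGroup K) [Fact (κ.IsTopGenerator γ)]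
        (𝔭 : IsDedekindDomain.HeightOneSpectrum (NumberField.RingOfIntegers K)),
        ((3 : ℕ) : NumberField.RingOfIntegers K) ∈ 𝔭.asIdeal →
        𝔭.asIdeal.ramificationIdx (NumberField.RingOfIntegers ℚ) = 1 →
        𝔭.asIdeal.inertiaDeg (NumberField.RingOfIntegers ℚ) = 1 →
      ∀ (𝔭' : IsDedekindDomain.HeightOneSpectrum (NumberField.RingOfIntegers K)),
        ((3 : ℕ) : NumberField.RingOfIntegers K) ∈ 𝔭'.asIdeal → 𝔭' ≠ 𝔭 →
      Set.Finite {s : Summit.BirchSwinnertonDyer.Rank1Residual.X11b.AcSelmer.selmerAc (W.baseChange K) 3 κ 𝔭' ∅ |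
        (3 : ℕ) • s = 0}) :
    ∀ (W : WeierstrassCurve ℚ) [W.IsElliptic] [W.IsGloballyMinimal] (N : ℕ) [NeZero N] (K : Type) [Field K] [NumberField K] (Dt : Literature.NumberTheory.EllipticCurves.ModularForms.ModularParametrizationData W N), Summit.BirchSwinnertonDyer.Rank1Residual.Additive.ClassO6 W 3 → Literature.NumberTheory.EllipticCurves.Rank1Residual.Red W 3 → (∃ Φ : AddSubgroup (WeierstrassCurve.geomTorsion W ((3 : ℕ) : ℤ)), Literature.NumberTheory.EllipticCurves.Rank1Residual.IsRationalLine W 3 Φ ∧ ∀ (v : IsDedekindDomain.HeightOneSpectrum (NumberField.RingOfIntegers ℚ)), ((3 : ℕ) : NumberField.RingOfIntegers ℚ) ∈ v.asIdeal → ∀ 𝔓 ∈ v.primesAbove, ¬ (∀ g ∈ 𝔓.decompositionSubgroup (Field.absoluteGaloisGroup ℚ), ∀ P ∈ Φ, g • P = P) ∧ ¬ (∀ g ∈ 𝔓.decompositionSubgroup (Field.absoluteGaloisGroup ℚ), ∀ P : WeierstrassCurve.geomTorsion W ((3 : ℕ) : ℤ), g • P - P ∈ Φ)) → W.analyticRank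 = 1 → W.conductorNorm ℤ = N → Literature.NumberTheory.EllipticCurves.IsImaginaryQuadratic K → Literature.NumberTheory.EllipticCurves.SatisfiesHeegnerHypothesis N K → ∀ (κ : Literature.NumberTheory.EllipticCurves.ZpExtension K 3), κ.IsAnticyclotomic → ∀ (γ : Field.absoluteGaloisGroup K) [Fact (κ.IsTopGenerator γ)] (𝔭 : IsDedekindDomain.HeightOneSpectrum (NumberField.RingOfIntegers K)), ((3 : ℕ) : NumberField.RingOfIntegers K) ∈ 𝔭.asIdeal → 𝔭.asIdeal.ramificationIdx (NumberField.RingOfIntegers ℚ) = 1 → 𝔭.asIdeal.inertiaDeg (NumberField.RingOfIntegers ℚ) = 1 → ∀ (𝔭' : IsDedekindDomain.HeightOneSpectrum (NumberField.RingOfIntegers K)), ((3 : ℕ) : NumberField.RingOfIntegers K) ∈ 𝔭'.asIdeal → 𝔭' ≠ 𝔭 → ∀ (ι' : PadicAlgCl 3 ≃+* ℂ), Summit.BirchSwinnertonDyer.BirchSwinnertonDyer.Theorems.SchneiderFree.BranchInducesPrime 3 ι' 𝔭 → ∀ (ΩK : ℂ) (Ωp : ℂ_[3]) (L : Literature.NumberTheory.EllipticCurves.UnrSeries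 3), ΩK ≠ 0 → Ωp ≠ 0 → Literature.NumberTheory.EllipticCurves.IsBDPLFunction ι' 𝔭 κ γ Dt.f ΩK Ωp L → ∃ (g : Literature.NumberTheory.EllipticCurves.UnrSeries 3) (n : ℕ), (Summit.BirchSwinnertonDyer.Rank1Residual.X11b.AcSelmer.XAc.charIdeal (W.baseChange K) 3 κ 𝔭' ∅ γ).map (PowerSeries.map (Summit.BirchSwinnertonDyer.Rank1Residual.X11b.Halves.toUnr 3)) = Ideal.span {g} ∧ ‖((PowerSeries.coeff n g : Literature.NumberTheory.EllipticCurves.unrIntegers 3) : ℂ_[3])‖ = 1 := by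
  intro W _ _ N _ K _ _ Dt hO6 hRed hcell hr hN hK hHg κ hκ γ _ 𝔭 h𝔭 he hf 𝔭' h𝔭' hne _ι' _hι _ΩK _Ωp _L _hΩK
    _hΩp _hBDP
  exact xac_exists_generator_of_finite_pTorsion (W.baseChange K) 3 κ 𝔭' ∅ γ Set.finite_empty
    (h W N K Dt hO6 hRed hcell hr hN hK hHg κ hκ γ 𝔭 h𝔭 he hf 𝔭' h𝔭' hne)

/-- **STUB B ⇐ crux K2 `EisensteinCharacterInvariantsAtThree` (stmt-BirchSwinnertonDyer-24199) BY NAME**: K2's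
conclusion at a frame is `∃ g n, Ch·R₀⟦T⟧ = (g) ∧ (‖gᵢ‖ < 1, i < n) ∧ ‖gₙ‖ = 1 ∧ (‖Lᵢ‖ < 1, i < n) ∧ ‖Lₙ‖ = 1`;
clauses 1 and 3 are stub B. So line `birth` = {stub A (tempered inclusion)} modulo K2 — the vet's domination
`K1 ⇐ A + K2` (evidence W.lean §g on 24198) read at the level of the registered stubs.
[cite: GreenbergVatsal2000, p. 2, (1)–(2)] -/
theorem stub_charPrincipalMuZero_of_eisensteinCharacterInvariantsAtThree
    (h2 : Summit.BirchSwinnertonDyer.BirchSwinnertonDyer.Theses.CumulativeHeegnerLeopoldt.EisensteinCharacterInvariantsAtThree) :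
    ∀ (W : WeierstrassCurve ℚ) [W.IsElliptic] [W.IsGloballyMinimal] (N : ℕ) [NeZero N] (K : Type) [Field K] [NumberField K] (Dt : Literature.NumberTheory.EllipticCurves.ModularForms.ModularParametrizationData W N), Summit.BirchSwinnertonDyer.Rank1Residual.Additive.ClassO6 W 3 → Literature.NumberTheory.EllipticCurves.Rank1Residual.Red W 3 → (∃ Φ : AddSubgroup (WeierstrassCurve.geomTorsion W ((3 : ℕ) : ℤ)), Literature.NumberTheory.EllipticCurves.Rank1Residual.IsRationalLine W 3 Φ ∧ ∀ (v : IsDedekindDomain.HeightOneSpectrum (NumberField.RingOfIntegers ℚ)), ((3 : ℕ) : NumberField.RingOfIntegers ℚ) ∈ v.asIdeal → ∀ 𝔓 ∈ v.primesAbove, ¬ (∀ g ∈ 𝔓.decompositionSubgroup (Field.absoluteGaloisGroup ℚ), ∀ P ∈ Φ, g • P = P) ∧ ¬ (∀ g ∈ 𝔓.decompositionSubgroup (Field.absoluteGaloisGroup ℚ), ∀ P : WeierstrassCurve.geomTorsion W ((3 : ℕ) : ℤ), g • P - P ∈ Φ)) → W.analyticRank = 1 → W.conductorNorm ℤ = N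 → Literature.NumberTheory.EllipticCurves.IsImaginaryQuadratic K → Literature.NumberTheory.EllipticCurves.SatisfiesHeegnerHypothesis N K → ∀ (κ : Literature.NumberTheory.EllipticCurves.ZpExtension K 3), κ.IsAnticyclotomic → ∀ (γ : Field.absoluteGaloisGroup K) [Fact (κ.IsTopGenerator γ)] (𝔭 : IsDedekindDomain.HeightOneSpectrum (NumberField.RingOfIntegers K)), ((3 : ℕ) : NumberField.RingOfIntegers K) ∈ 𝔭.asIdeal → 𝔭.asIdeal.ramificationIdx (NumberField.RingOfIntegers ℚ) = 1 → 𝔭.asIdeal.inertiaDeg (NumberField.RingOfIntegers ℚ) = 1 → ∀ (𝔭' : IsDedekindDomain.HeightOneSpectrum (NumberField.RingOfIntegers K)), ((3 : ℕ) : NumberField.RingOfIntegers K) ∈ 𝔭'.asIdeal → 𝔭' ≠ 𝔭 → ∀ (ι' : PadicAlgCl 3 ≃+* ℂ), Summit.BirchSwinnertonDyer.BirchSwinnertonDyer.Theorems.SchneiderFree.BranchInducesPrime 3 ι' 𝔭 → ∀ (ΩK : ℂ) (Ωp : ℂ_[3]) (L : Literature.NumberTheory.EllipticCurves.UnrSeries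 3), ΩK ≠ 0 → Ωp ≠ 0 → Literature.NumberTheory.EllipticCurves.IsBDPLFunction ι' 𝔭 κ γ Dt.f ΩK Ωp L → ∃ (g : Literature.NumberTheory.EllipticCurves.UnrSeries 3) (n : ℕ), (Summit.BirchSwinnertonDyer.Rank1Residual.X11b.AcSelmer.XAc.charIdeal (W.baseChange K) 3 κ 𝔭' ∅ γ).map (PowerSeries.map (Summit.BirchSwinnertonDyer.Rank1Residual.X11b.Halves.toUnr 3)) = Ideal.span {g} ∧ ‖((PowerSeries.coeff n g : Literature.NumberTheory.EllipticCurves.unrIntegers 3) : ℂ_[3])‖ = 1 := by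
  intro W _ _ N _ K _ _ Dt hO6 hRed hcell hr hN hK hHg κ hκ γ _ 𝔭 h𝔭 he hf 𝔭' h𝔭' hne ι' hι ΩK Ωp L hΩK hΩp hBDP
  obtain ⟨g, n, hg, -, hunit, -, -⟩ :=
    h2 W N K Dt hO6 hRed hcell hr hN hK hHg κ hκ γ 𝔭 h𝔭 he hf 𝔭' h𝔭' hne ι' hι ΩK Ωp L hΩK hΩp hBDP
  exact ⟨g, n, hg, hunit⟩

/-- **At a single frame where stub B's hypotheses hold, its conclusion is EQUIVALENT to
`3 ∤ Ch_Λ(X_{∅,0}(𝔭′))`** — so stub B is exactly the statement «at every frame of the cell carrying a BDP measure,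
the characteristic ideal of `X_{∅,0}(𝔭′)` is prime to `3`», i.e. `μ_alg = 0` on the torsion locus (and vacuous
off it). Recorded for the line's census. [cite: GreenbergVatsal2000, p. 2, (1)–(2)] [cite: Castella2018, Thm. 2.3 (arXiv:1704.06608 p. 5)] -/
theorem stubB_conclusion_iff_not_le {K : Type} [Field K] [NumberField K] (E : WeierstrassCurve K)
    (κ : ZpExtension K 3) (𝔭' : HeightOneSpectrum (𝓞 K)) (γ : absoluteGaloisGroup K)
    [Fact (κ.IsTopGenerator γ)] :
    (∃ (g : UnrSeries 3) (n : ℕ),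
        (XAc.charIdeal E 3 κ 𝔭' ∅ γ).map (PowerSeries.map (Halves.toUnr 3)) = Ideal.span {g} ∧
          ‖((PowerSeries.coeff n g : unrIntegers 3) : ℂ_[3])‖ = 1) ↔
      ¬ XAc.charIdeal E 3 κ 𝔭' ∅ γ ≤ augIdealP 3 :=
  xac_exists_generator_iff_not_le_augIdealP E 3 κ 𝔭' ∅ γ

/-- **The same frame-level conclusion for an elliptic `E`, read as `μ = 0` on the torsion locus.**
[cite: GreenbergVatsal2000, p. 2, (1)–(2)] [cite: Washington1997, §13.2] -/
theorem stubB_conclusion_iff_isTorsion_imp_mu_eq_zero {K : Type} [Field K] [NumberField K]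
    (E : WeierstrassCurve K) [E.IsElliptic] (κ : ZpExtension K 3) (𝔭' : HeightOneSpectrum (𝓞 K))
    (γ : absoluteGaloisGroup K) [Fact (κ.IsTopGenerator γ)] :
    (∃ (g : UnrSeries 3) (n : ℕ),
        (XAc.charIdeal E 3 κ 𝔭' ∅ γ).map (PowerSeries.map (Halves.toUnr 3)) = Ideal.span {g} ∧
          ‖((PowerSeries.coeff n g : unrIntegers 3) : ℂ_[3])‖ = 1) ↔
      (Module.IsTorsion (IwasawaAlgebra 3) (XAc E 3 κ 𝔭' ∅ γ) → muInvariant 3 (XAc E 3 κ 𝔭' ∅ γ) = 0) :=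
  xac_exists_generator_iff E 3 κ 𝔭' ∅ γ Set.finite_empty

end StubB

end Summit.BirchSwinnertonDyer.BirchSwinnertonDyer.Theorems.CumulativeHeegnerInclusionAtThreeStubB

end
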